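import Mathlib.Analysis.SpecialFunctions.Exponential
import Mathlib.Analysis.Calculus.Deriv.Mul
import Literature.MathematicalPhysics.QuantumLattice.SpinChains
import Literature.MathematicalPhysics.QuantumLattice.LiebMattisLadder
import Literature.MathematicalPhysics.QuantumLattice.SpinSystemProofs
import Literature.MathematicalPhysics.QuantumLattice.HeisenbergModelProofs
import HarnessLib

/-!
# Higher-dimensional Lieb–Schultz–Mattis (`higherDim_lsm`): the odd-length half

Sibling proof file (theorems only, no definitions, no new named facts) of
`Literature/MathematicalPhysics/QuantumLattice/SpinChains.lean`, first step towards the discharge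
of the named fact `higherDim_lsm` (Hastings, PRB 69 (2004) 104431; Nachtergaele–Sims, CMP 276
(2007) 437, Thm 1.1). The printed theorem (Nachtergaele–Sims Thm 1.1) assumes that the length `L`
of the periodic direction is **even**; for a torus `ℤ/L × ℤ/W` of spin-`1/2`'s with `W` odd and
`L` odd the hypothesis "the ground state is unique" of `higherDim_lsm` is never satisfied, so that
the odd-`L` half of `higherDim_lsm` holds vacuously (Nachtergaele–Sims (2007) §1.5: "For `L` odd,
our assumptions preclude the existence of such an eigenvector"). This file proves exactly that,
for the tree's finite-volume objects `rectTorusHamiltonian Φ Ls` of `LocalDynamics.lean`: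

* `commute_of_forall_commute_exp_smul`: an observable commuting with the one-parameter group
  `t ↦ e^{tA}` commutes with its generator (derivative at `t = 0`, Mathlib
  `hasDerivAt_exp_smul_const`);
* `commute_totalSpin_of_forall_commute_globalRotation`: `SU(2)` invariance `[A, Û(θ)] = 0` for all
  `θ` implies `[A, Ŝ^α_tot] = 0` (`Û(θ) = exp(-iθ·𝐒_tot)`, `globalRotation_eq_exp_totalSpin`);
* `wrapTerm_eq_localOp_reindexOp`, `commute_wrapTerm_totalSpin`,
  `commute_rectTorusHamiltonian_totalSpin`: the torus Hamiltonian of a rotation-invariant lattice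
  interaction (`LatticeInteraction.IsRotationInvariant`) commutes with the three components of the
  total spin of the torus (the wrapped terms are local operators transported along the projection
  `ℤ^d → 𝕋`, injective on wrap representatives);
* `not_hasUniqueGroundState_of_commute_totalSpin_of_odd`: an `SU(2)`-invariant Hamiltonian on an
  **odd** number of spin-`1/2`'s has no non-degenerate eigenvalue at the bottom of its spectrum —
  a one-dimensional invariant subspace carries `Ŝ^α_tot ψ = c_α ψ`, whence
  `i Ŝᶻ_tot ψ = [Ŝˣ_tot, Ŝʸ_tot] ψ = 0`, while `Ŝᶻ_tot` is diagonal with half-odd-integer entries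
  (Kramers/`SU(2)` degeneracy; Tasaki (2020) §2.2–2.3; Nachtergaele–Sims (2007) §1.5);
* `not_hasUniqueGroundState_rectTorusHamiltonian`, `higherDim_lsm_of_odd_length`: the odd-`L`
  (and odd-`W`) case of `higherDim_lsm` is vacuous.

The even-`L` half (the content of Nachtergaele–Sims Thm 1.1: twisted Hamiltonians, Hastings'
trial state, Lieb–Robinson bounds) is not in this file.

## Sources

* B. Nachtergaele, R. Sims, *A multi-dimensional Lieb–Schultz–Mattis theorem*, Comm. Math. Phys.
  **276** (2007) 437–472, Thm 1.1, conditions LSM3–LSM5 and §1.5. [NachtergaeleSimsCMP2007]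
* H. Tasaki, *Physics and Mathematics of Quantum Many-Body Systems* (Springer, 2020), §2.2
  (eqs. (2.2.10)–(2.2.13)), §2.3 (time reversal / Kramers degeneracy for half-odd-integer spin).
* Ingredients from the tree: `globalRotation_eq_exp_totalSpin` (`HeisenbergModelGlobalRotationProofs`),
  `LiebMattis.totalSpin_two_eq_diagonal`, `LiebMattis.totalSpin_zero_commutator_one`,
  `LiebMattis.magnetisation_eq_sub_weight` (`LiebMattisLadder`), `localOp_mul_holds`,
  `commute_of_disjoint_holds`, `isSupportedOn_onSite_holds` (`SpinSystemProofs`),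
  `reindexOp_apply`, `reindexOp_siteSpin` (`HeisenbergModelProofs`).
-/

noncomputable section

open Matrix Complex Finset
open scoped Matrix.Norms.L2Operator

namespace Literature.MathematicalPhysics.QuantumLattice

namespace HigherDimLSM

open Literature.Probability.LatticeModels

/-! ### Infinitesimal invariance from invariance under a one-parameter group -/

section Infinitesimal

variable {m : Type*} [Fintype m] [DecidableEq m]

/-- **Generator of a commuting one-parameter group.** If `B` commutes with `e^{tA}` for every real
`t`, then `B` commutes with `A` (differentiate `B e^{tA} = e^{tA} B` at `t = 0`; Mathlib
`hasDerivAt_exp_smul_const`, uniqueness of derivatives). Tasaki (2020) §2.2, around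
eq. (2.2.12). [folklore] -/
theorem commute_of_forall_commute_exp_smul {A B : Matrix m m ℂ}
    (h : ∀ t : ℝ, Commute B (NormedSpace.exp (t • A))) : Commute B A := by
  have hd : HasDerivAt (fun u : ℝ => NormedSpace.exp (u • A))
      (NormedSpace.exp ((0 : ℝ) • A) * A) 0 :=
    hasDerivAt_exp_smul_const A 0
  rw [zero_smul, NormedSpace.exp_zero, one_mul] at hd
  have h1 : HasDerivAt (fun u : ℝ => B * NormedSpace.exp (u • A)) (B * A) 0 := hd.const_mul B
  have h2 : HasDerivAt (fun u : ℝ => NormedSpace.exp (u • A) * B) (A * B) 0 := hd.mul_const B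
  have hfun : (fun u : ℝ => B * NormedSpace.exp (u • A)) =
      fun u : ℝ => NormedSpace.exp (u • A) * B :=
    funext fun u => (h u).eq
  rw [hfun] at h1
  exact h1.unique h2

variable {Λ : Type*} [Fintype Λ] [DecidableEq Λ]

/-- **`SU(2)` invariance implies infinitesimal invariance**: an observable commuting with every
global rotation `Û(θ) = ⨂_x exp(-iθ·𝐒_x) = exp(-iθ·𝐒_tot)` commutes with the three components of
the total spin (take `θ = t e_α` and differentiate at `t = 0`). Tasaki (2020) §2.2,
eqs. (2.2.11)–(2.2.12); Nachtergaele–Sims (2007), condition LSM3. [folklore] -/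
theorem commute_totalSpin_of_forall_commute_globalRotation {n : ℕ} {A : Op Λ (n + 1)}
    (h : ∀ θ : Fin 3 → ℝ, Commute A (globalRotation n θ)) (α : Fin 3) :
    Commute A (totalSpin n α) := by
  have key : ∀ t : ℝ, Commute A (NormedSpace.exp (t • ((-I) • totalSpin (Λ := Λ) n α))) := by
    intro t
    have h1 := h (Pi.single α t)
    rw [globalRotation_eq_exp_totalSpin] at h1
    have hsum : (∑ β : Fin 3, ((Pi.single α t : Fin 3 → ℝ) β : ℂ) • totalSpin (Λ := Λ) n β) =
        (t : ℂ) • totalSpin n α := by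
      rw [Finset.sum_eq_single α]
      · rw [Pi.single_eq_same]
      · intro β _ hβ
        rw [Pi.single_eq_of_ne hβ, Complex.ofReal_zero, zero_smul]
      · intro hα
        exact absurd (Finset.mem_univ α) hα
    rw [hsum, smul_comm, Complex.coe_smul] at h1
    exact h1
  have hc := (commute_of_forall_commute_exp_smul key).smul_right I
  rwa [smul_smul, mul_neg, I_mul_I, neg_neg, one_smul] at hc

end Infinitesimal

/-! ### Local operators and the total spin -/

section Local

variable {Λ : Type*} [Fintype Λ] [DecidableEq Λ] {q : ℕ}

/-- Placing a single-site operator at `y ∈ Y` in the region algebra `𝔄_Y` and embedding `𝔄_Y ↪ 𝔄_Λ`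
is placing it at `y`: `(𝟙 ⊗ a_y ⊗ 𝟙)_Y ⊗ 𝟙_{Λ∖Y} = 𝟙 ⊗ a_y ⊗ 𝟙`. Bratteli–Robinson II §6.2.1
(isotony); Tasaki (2020) §2.2, eq. (2.2.5). [folklore] -/
theorem localOp_onSite (Y : Finset Λ) (y : ↥Y) (a : Matrix (Fin q) (Fin q) ℂ) :
    localOp Y (onSite y a : Op ↥Y q) = (onSite (y : Λ) a : Op Λ q) := by
  ext σ τ
  rw [localOp_apply, onSite_apply, onSite_apply]
  by_cases h1 : ∀ z, z ≠ (y : Λ) → σ z = τ z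
  · rw [if_pos h1]
    have h2 : ∀ z, z ∉ Y → σ z = τ z := fun z hz => h1 z fun h => hz (h ▸ y.2)
    rw [if_pos h2]
    have h3 : ∀ z : ↥Y, z ≠ y → (fun x : ↥Y => σ x) z = (fun x : ↥Y => τ x) z :=
      fun z hz => h1 z fun h => hz (Subtype.ext h)
    rw [if_pos h3]
  · rw [if_neg h1]
    split_ifs with h2 h3
    · exfalso
      refine h1 fun z hz => ?_
      by_cases hzY : z ∈ Y
      · exact h3 ⟨z, hzY⟩ fun h => hz (congrArg Subtype.val h)
      · exact h2 z hzY
    · rfl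
    · rfl

/-- The total spin of the region `Y`, embedded in `𝔄_Λ`, is `Σ_{y ∈ Y} Ŝ^α_y`. Tasaki (2020) §2.2,
eq. (2.2.11). [folklore] -/
theorem localOp_totalSpin (n : ℕ) (Y : Finset Λ) (α : Fin 3) :
    localOp Y (totalSpin (Λ := ↥Y) n α) = ∑ y : ↥Y, (siteSpin n (y : Λ) α : Op Λ (n + 1)) := by
  have hsum : localOp Y (∑ y : ↥Y, (siteSpin n y α : Op ↥Y (n + 1))) =
      ∑ y : ↥Y, localOp Y (siteSpin n y α : Op ↥Y (n + 1)) :=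
    map_sum (AddMonoidHom.mk' (localOp (q := n + 1) Y) (localOp_add Y)) _ _
  rw [totalSpin, hsum]
  exact Finset.sum_congr rfl fun y _ => localOp_onSite Y y _

/-- **A local operator that is rotation invariant in its region commutes with the total spin of
the whole system**: if `A ∈ 𝔄_Y` commutes with `Ŝ^α_tot(Y)` for all `α`, then `A ⊗ 𝟙` commutes with
`Ŝ^α_tot(Λ) = Ŝ^α_tot(Y) ⊗ 𝟙 + Σ_{y ∉ Y} Ŝ^α_y` (the second sum has disjoint support).
Tasaki (2020) §2.2, eqs. (2.2.6), (2.2.11). [folklore] -/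
theorem commute_localOp_totalSpin {n : ℕ} (Y : Finset Λ) {A : Op ↥Y (n + 1)}
    (hA : ∀ α, Commute A (totalSpin (Λ := ↥Y) n α)) (α : Fin 3) :
    Commute (localOp Y A) (totalSpin (Λ := Λ) n α) := by
  have hsplit : (totalSpin (Λ := Λ) n α) =
      ∑ y ∈ Y, (siteSpin n y α : Op Λ (n + 1)) + ∑ y ∈ Yᶜ, siteSpin n y α := by
    rw [totalSpin, Finset.sum_add_sum_compl]
  rw [hsplit]
  refine Commute.add_right ?_ (Commute.sum_right _ _ _ fun y hy => ?_)
  · rw [← Finset.sum_coe_sort Y, ← localOp_totalSpin]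
    show localOp Y A * localOp Y _ = localOp Y _ * localOp Y A
    rw [← localOp_mul_holds Y A, (hA α).eq, localOp_mul_holds Y]
  · exact commute_of_disjoint_holds (isSupportedOn_localOp Y A) (isSupportedOn_onSite_holds y _)
      (Finset.disjoint_singleton_right.2 (Finset.mem_compl.1 hy))

/-- Relabelling sites moves the total spin: `reindexOp e (Ŝ^α_tot(Λ)) = Ŝ^α_tot(Λ')`.
Tasaki (2020) §2.2, eq. (2.2.11). [folklore] -/
theorem reindexOp_totalSpin {Λ' : Type*} [Fintype Λ'] [DecidableEq Λ'] (e : Λ ≃ Λ') (n : ℕ)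
    (α : Fin 3) : reindexOp e (totalSpin (Λ := Λ) n α) = totalSpin (Λ := Λ') n α := by
  simp only [totalSpin, map_sum, reindexOp_siteSpin]
  exact Equiv.sum_comp e (fun y => (siteSpin n y α : Op Λ' (n + 1)))

end Local

/-! ### Wrapped terms on the torus commute with the total spin -/

section Torus

variable {d q : ℕ}

/-- **A wrapped term is a transported local operator**: if `e : X ≃ proj X` lifts the projection
`ℤ^d → 𝕋` on `X`, then `wrapTerm Ls X A = (reindexOp e A) ⊗ 𝟙_{𝕋 ∖ proj X}`.
Bratteli–Robinson II §6.2.1; Hastings (2004) (periodic boundary conditions). [folklore] -/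
theorem wrapTerm_eq_localOp_reindexOp (Ls : Fin d → ℕ) [∀ i, NeZero (Ls i)] (X : Finset (Site d))
    (e : ↥X ≃ ↥(X.image (RectTorus.proj Ls)))
    (he : ∀ x : ↥X, ((e x : ↥(X.image (RectTorus.proj Ls))) : RectTorusSite Ls) =
      RectTorus.proj Ls x)
    (A : Matrix (X → Fin q) (X → Fin q) ℂ) :
    wrapTerm Ls X A = localOp (X.image (RectTorus.proj Ls)) (reindexOp e A) := by
  classical
  ext σ τ
  simp only [wrapTerm, localOp_apply, of_apply, reindexOp_apply]
  split_ifs with h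
  · congr 1 <;> funext x <;> rw [he]
  · rfl

/-- A lift of the projection `ℤ^d → 𝕋` to an equivalence `X ≃ proj X`, for `X` on which the
projection is injective. [folklore] -/
theorem exists_equiv_image (Ls : Fin d → ℕ) (X : Finset (Site d))
    (hinj : Set.InjOn (RectTorus.proj Ls) X) :
    ∃ e : ↥X ≃ ↥(X.image (RectTorus.proj Ls)),
      ∀ x : ↥X, ((e x : ↥(X.image (RectTorus.proj Ls))) : RectTorusSite Ls) =
        RectTorus.proj Ls x := by
  refine ⟨Equiv.ofBijective (fun x => ⟨RectTorus.proj Ls x, Finset.mem_image_of_mem _ x.2⟩)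
    ⟨fun a b h => Subtype.ext (hinj a.2 b.2 (congrArg Subtype.val h)), ?_⟩, fun x => rfl⟩
  rintro ⟨y, hy⟩
  obtain ⟨x, hx, rfl⟩ := Finset.mem_image.1 hy
  exact ⟨⟨x, hx⟩, rfl⟩

/-- **The projection is injective on wrap representatives**: two distinct points of `X` with the
same image in `Π i, ℤ/(Ls i)ℤ` differ by a nonzero multiple of `Ls i` in some coordinate `i`, so
`Ls i ≤ diam X`, contradicting `2 diam X < Ls i`. Hastings (2004) (terms that "do not feel" the
periodicity). [folklore] -/
theorem injOn_proj_of_isWrapRepresentative {Ls : Fin d → ℕ} {X : Finset (Site d)}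
    (hX : IsWrapRepresentative Ls X) : Set.InjOn (RectTorus.proj Ls) X := by
  obtain ⟨-, -, hdiam⟩ := hX
  intro x hx y hy hxy
  by_contra hne
  obtain ⟨i, hi⟩ : ∃ i, x i ≠ y i := by
    by_contra h
    push Not at h
    exact hne (funext h)
  have hmod : ((x i : ℤ) : ZMod (Ls i)) = ((y i : ℤ) : ZMod (Ls i)) := congrFun hxy i
  rw [ZMod.intCast_eq_intCast_iff_dvd_sub] at hmod
  obtain ⟨k, hk⟩ := hmod
  have hk0 : k ≠ 0 := by
    rintro rfl
    rw [mul_zero, sub_eq_zero] at hk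
    exact hi hk.symm
  have hdist : dist x y ≤ Metric.diam (X : Set (Site d)) :=
    Metric.dist_le_diam_of_mem X.finite_toSet.isBounded hx hy
  have hcoord : dist (x i) (y i) ≤ dist x y := dist_le_pi_dist x y i
  have hLs : (Ls i : ℝ) ≤ dist (x i) (y i) := by
    rw [Int.dist_eq]
    have hxy' : ((x i : ℤ) : ℝ) - ((y i : ℤ) : ℝ) = -((Ls i : ℝ) * (k : ℝ)) := by
      have : (x i : ℤ) - y i = -((Ls i : ℤ) * k) := by linarith
      exact_mod_cast this
    rw [hxy', abs_neg, abs_mul, Nat.abs_cast]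
    have h1 : (1 : ℝ) ≤ |(k : ℝ)| := by exact_mod_cast Int.one_le_abs hk0
    nlinarith [Nat.cast_nonneg (α := ℝ) (Ls i)]
  have h2 := hdiam i
  linarith [Metric.diam_nonneg (s := (X : Set (Site d)))]

/-- **A wrapped rotation-invariant term commutes with the total spin of the torus.** If the
projection is injective on `X` and `A ∈ 𝔄_X` commutes with `Ŝ^α_tot(X)` for all `α`, then
`wrapTerm Ls X A` commutes with `Ŝ^α_tot(𝕋)`. Nachtergaele–Sims (2007), condition LSM3;
Tasaki (2020) §2.2. [folklore] -/
theorem commute_wrapTerm_totalSpin {n : ℕ} {Ls : Fin d → ℕ} [∀ i, NeZero (Ls i)]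
    {X : Finset (Site d)} (hX : Set.InjOn (RectTorus.proj Ls) X)
    {A : Matrix (X → Fin (n + 1)) (X → Fin (n + 1)) ℂ}
    (hA : ∀ α, Commute A (totalSpin (Λ := ↥X) n α)) (α : Fin 3) :
    Commute (wrapTerm Ls X A) (totalSpin (Λ := RectTorusSite Ls) n α) := by
  obtain ⟨e, he⟩ := exists_equiv_image Ls X hX
  rw [wrapTerm_eq_localOp_reindexOp Ls X e he]
  refine commute_localOp_totalSpin _ (fun β => ?_) α
  have h := (hA β).map (reindexOp (q := n + 1) e)
  rwa [reindexOp_totalSpin] at h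

/-- **The torus interaction of a rotation-invariant lattice interaction is rotation invariant**:
every term `(rectTorusInteraction Φ Ls) Y` commutes with the total spin of the torus.
Nachtergaele–Sims (2007), condition LSM3 (with periodic boundary conditions, §1.2);
Hastings (2004). [folklore] -/
theorem commute_rectTorusInteraction_totalSpin {n : ℕ} {Φ : LatticeInteraction d (n + 1)}
    (hrot : Φ.IsRotationInvariant) (Ls : Fin d → ℕ) [∀ i, NeZero (Ls i)]
    (Y : Finset (RectTorusSite Ls)) (α : Fin 3) :
    Commute (rectTorusInteraction Φ Ls Y) (totalSpin n α) := by
  unfold rectTorusInteraction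
  rw [Interaction.mk_apply]
  refine finsum_induction (fun M => Commute M (totalSpin (Λ := RectTorusSite Ls) n α))
    (Commute.zero_left _) (fun _ _ h1 h2 => h1.add_left h2) fun X => ?_
  refine finsum_induction (fun M => Commute M (totalSpin (Λ := RectTorusSite Ls) n α))
    (Commute.zero_left _) (fun _ _ h1 h2 => h1.add_left h2) fun hX => ?_
  exact commute_wrapTerm_totalSpin (injOn_proj_of_isWrapRepresentative hX.1)
    (fun β => commute_totalSpin_of_forall_commute_globalRotation (fun θ => hrot θ X) β) α

/-- **The torus Hamiltonian of a rotation-invariant lattice interaction is `SU(2)` invariant**: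
`[H_𝕋, Ŝ^α_tot] = 0` for `α = 1, 2, 3`. Nachtergaele–Sims (2007), conditions LSM3 and §1.2;
Hastings (2004). [folklore] -/
theorem commute_rectTorusHamiltonian_totalSpin {n : ℕ} {Φ : LatticeInteraction d (n + 1)}
    (hrot : Φ.IsRotationInvariant) (Ls : Fin d → ℕ) [∀ i, NeZero (Ls i)] (α : Fin 3) :
    Commute (rectTorusHamiltonian Φ Ls) (totalSpin n α) := by
  unfold rectTorusHamiltonian localHamiltonian
  exact Commute.sum_left _ _ _ fun Y _ => commute_rectTorusInteraction_totalSpin hrot Ls Y α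

end Torus

/-! ### Kramers-type degeneracy: odd number of spin-`1/2`'s -/

section Kramers

variable {Λ : Type*} [Fintype Λ] [DecidableEq Λ]

/-- **No non-degenerate ground state for an `SU(2)`-invariant Hamiltonian on an odd number of
spin-`1/2`'s.** If `H` commutes with `Ŝˣ_tot, Ŝʸ_tot, Ŝᶻ_tot` and `|Λ|` is odd, then
`dim ker (H - E₀) ≠ 1`: a one-dimensional invariant subspace `ℂψ` would give `Ŝ^α_tot ψ = c_α ψ`,
hence `i Ŝᶻ_tot ψ = [Ŝˣ_tot, Ŝʸ_tot] ψ = 0`; but `Ŝᶻ_tot` is diagonal in the product basis with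
entries `|Λ|/2 - (integer) ≠ 0`, so `ψ = 0`. (Every eigenspace is a representation of `SU(2)`
with only half-odd-integer spins, hence even-dimensional.) Tasaki (2020) §2.2–2.3;
Nachtergaele–Sims (2007) §1.5. [folklore] -/
theorem not_hasUniqueGroundState_of_commute_totalSpin_of_odd (H : Op Λ 2)
    (hc : ∀ α, Commute H (totalSpin (Λ := Λ) 1 α)) (hodd : Odd (Fintype.card Λ)) :
    ¬ H.HasUniqueGroundState := by
  intro hu
  unfold Matrix.HasUniqueGroundState Matrix.groundStateDegeneracy at hu
  rw [finrank_eq_one_iff'] at hu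
  obtain ⟨⟨ψ, hψmem⟩, hv0, hspan⟩ := hu
  have hψ0 : ψ ≠ 0 := fun h => hv0 ((Submodule.mk_eq_zero _ _).2 h)
  have hmem : ∀ α, (totalSpin (Λ := Λ) 1 α) *ᵥ ψ ∈ H.groundSpace := by
    intro α
    have hψ := hψmem
    rw [Matrix.mem_groundSpace_iff] at hψ ⊢
    rw [Matrix.mulVec_mulVec, (hc α).eq, ← Matrix.mulVec_mulVec, hψ, Matrix.mulVec_smul]
  have heig : ∀ α, ∃ c : ℂ, (totalSpin (Λ := Λ) 1 α) *ᵥ ψ = c • ψ := by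
    intro α
    obtain ⟨c, hc'⟩ := hspan ⟨_, hmem α⟩
    exact ⟨c, by simpa using (congrArg Subtype.val hc').symm⟩
  obtain ⟨a, ha⟩ := heig 0
  obtain ⟨b, hb⟩ := heig 1
  have hz : (totalSpin (Λ := Λ) 1 2) *ᵥ ψ = 0 := by
    have hxy : (totalSpin 1 0 * totalSpin 1 1 - totalSpin 1 1 * totalSpin 1 0 : Op Λ 2) *ᵥ ψ =
        0 := by
      rw [Matrix.sub_mulVec, ← Matrix.mulVec_mulVec, ← Matrix.mulVec_mulVec, hb, ha,
        Matrix.mulVec_smul, Matrix.mulVec_smul, ha, hb, smul_smul, smul_smul, mul_comm a b,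
        sub_self]
    rw [LiebMattis.totalSpin_zero_commutator_one, Matrix.smul_mulVec] at hxy
    exact (smul_eq_zero.1 hxy).resolve_left I_ne_zero
  rw [LiebMattis.totalSpin_two_eq_diagonal] at hz
  refine hψ0 (funext fun σ => ?_)
  have hσ := congrFun hz σ
  rw [mulVec_diagonal, Pi.zero_apply] at hσ
  rcases mul_eq_zero.1 hσ with h | h
  · exfalso
    rw [LiebMattis.magnetisation_eq_sub_weight, sub_eq_zero, mul_one] at h
    have h2 : (Fintype.card Λ : ℂ) = 2 * ((∑ x, (σ x : ℕ) : ℕ) : ℂ) := by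
      linear_combination 2 * h
    have h3 : Fintype.card Λ = 2 * ∑ x, (σ x : ℕ) := by exact_mod_cast h2
    refine (Nat.not_even_iff_odd.2 hodd) ?_
    rw [h3]
    exact even_two_mul _
  · exact h

end Kramers

/-! ### The odd-length case of `higherDim_lsm` -/

section OddLength

variable {d : ℕ}

/-- The rectangular torus `Π i, ℤ/(Ls i)ℤ` has `∏ i, Ls i` sites. [folklore] -/
theorem card_rectTorusSite (Ls : Fin d → ℕ) [∀ i, NeZero (Ls i)] :
    Fintype.card (RectTorusSite Ls) = ∏ i, Ls i := by
  simp [Fintype.card_pi, ZMod.card]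

/-- **Kramers/`SU(2)` degeneracy on odd tori.** For a rotation-invariant interaction of
spin-`1/2`'s (`LatticeInteraction d 2`, `Φ.IsRotationInvariant`) on a rectangular torus with an odd
number `∏ i, Ls i` of sites, the torus Hamiltonian `rectTorusHamiltonian Φ Ls` does **not** have a
unique ground state. Nachtergaele–Sims (2007) §1.5 ("For `L` odd, our assumptions preclude the
existence of such an eigenvector"); Tasaki (2020) §2.3. [cite: NachtergaeleSimsCMP2007, §1.5] -/
theorem not_hasUniqueGroundState_rectTorusHamiltonian {Φ : LatticeInteraction d 2}
    (hrot : Φ.IsRotationInvariant) (Ls : Fin d → ℕ) [∀ i, NeZero (Ls i)]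
    (hodd : Odd (∏ i, Ls i)) : ¬ (rectTorusHamiltonian Φ Ls).HasUniqueGroundState :=
  not_hasUniqueGroundState_of_commute_totalSpin_of_odd _
    (fun α => commute_rectTorusHamiltonian_totalSpin hrot Ls α) (by rwa [card_rectTorusSite])

/-- The two-dimensional case: on `ℤ/L × ℤ/W` with `L` and `W` odd, an `SU(2)`-invariant
spin-`1/2` torus Hamiltonian has no unique ground state. Nachtergaele–Sims (2007) §1.5.
[cite: NachtergaeleSimsCMP2007, §1.5] -/
theorem not_hasUniqueGroundState_rectTorusHamiltonian_two {Φ : LatticeInteraction 2 2}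
    (hrot : Φ.IsRotationInvariant) (L W : ℕ) [∀ i, NeZero (![L, W] i)] (hL : Odd L)
    (hW : Odd W) : ¬ (rectTorusHamiltonian Φ ![L, W]).HasUniqueGroundState :=
  not_hasUniqueGroundState_rectTorusHamiltonian hrot _
    (by simpa [Fin.prod_univ_two] using hL.mul hW)

/-- **The odd-length half of `higherDim_lsm` is vacuous.** For `L` odd (and `W` odd, as in
`higherDim_lsm`) the uniqueness hypothesis fails, so the gap bound `E₁ - E₀ ≤ C log L / L` holds
for every constant `C`; only rotation invariance of `Φ` is used. Nachtergaele–Sims (2007) Thm 1.1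
is stated for even `L`; §1.5 loc. cit. for odd `L`. [cite: NachtergaeleSimsCMP2007, §1.5] -/
theorem higherDim_lsm_of_odd_length (Φ : LatticeInteraction 2 2) (hrot : Φ.IsRotationInvariant)
    (C : ℝ) (L W : ℕ) [∀ i, NeZero (![L, W] i)] (hL : Odd L) (hW : Odd W)
    (hu : (rectTorusHamiltonian Φ ![L, W]).HasUniqueGroundState) :
    (rectTorusHamiltonian Φ ![L, W]).spectralGap ≤ C * Real.log L / L :=
  absurd hu (not_hasUniqueGroundState_rectTorusHamiltonian_two hrot L W hL hW)

/-! ### Bookkeeping: reduction of `higherDim_lsm` to large even lengths -/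

/-- **Reduction to large even `L`.** Fix a rotation-invariant `Φ`. If the gap bound
`E₁ - E₀ ≤ C₀ log L / L` holds on the tori `ℤ/L × ℤ/W` with `L` even, `L ≥ L₀`, `W ≤ L` odd and a
unique ground state (the content of Nachtergaele–Sims (2007) Thm 1.1, which is stated for even `L`
"large enough"), then the conclusion of `higherDim_lsm` holds for `Φ` with some constant `C`: odd
`L` is vacuous (`higherDim_lsm_of_odd_length`), and the finitely many tori with `2 ≤ L < L₀`,
`W ≤ L` are absorbed into the constant (`log L / L > 0` for `L ≥ 2`). Nachtergaele–Sims (2007)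
Thm 1.1 and §1.5. [cite: NachtergaeleSimsCMP2007, Thm 1.1] -/
theorem higherDim_lsm_reduction (Φ : LatticeInteraction 2 2) (hrot : Φ.IsRotationInvariant)
    (L₀ : ℕ) (C₀ : ℝ)
    (h : ∀ (L W : ℕ) [∀ i, NeZero (![L, W] i)], Even L → L₀ ≤ L → Odd W → W ≤ L →
      (rectTorusHamiltonian Φ ![L, W]).HasUniqueGroundState →
        (rectTorusHamiltonian Φ ![L, W]).spectralGap ≤ C₀ * Real.log L / L) :
    ∃ C : ℝ, ∀ (L W : ℕ) [∀ i, NeZero (![L, W] i)], Odd W → 2 ≤ L → W ≤ L →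
      (rectTorusHamiltonian Φ ![L, W]).HasUniqueGroundState →
        (rectTorusHamiltonian Φ ![L, W]).spectralGap ≤ C * Real.log L / L := by
  obtain ⟨g, hg⟩ : ∃ g : ℕ → ℕ → ℝ, ∀ (L W : ℕ) [∀ i, NeZero (![L, W] i)],
      g L W = (rectTorusHamiltonian Φ ![L, W]).spectralGap * L / Real.log L := by
    classical
    exact ⟨fun L W => if hLW : (∀ i, NeZero (![L, W] i)) then
        (haveI := hLW; (rectTorusHamiltonian Φ ![L, W]).spectralGap * L / Real.log L) else 0,
      fun L W hLW => dif_pos hLW⟩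
  refine ⟨max C₀ (∑ L ∈ Finset.range L₀, ∑ W ∈ Finset.range L₀, |g L W|),
    fun L W _ hW hL hWL hu => ?_⟩
  have hL1 : (1 : ℝ) < L := by exact_mod_cast hL
  have hlog : 0 < Real.log L := Real.log_pos hL1
  have hLpos : (0 : ℝ) < L := one_pos.trans hL1
  rcases Nat.even_or_odd L with hev | hodd
  · by_cases hL₀ : L₀ ≤ L
    · refine (h L W hev hL₀ hW hWL hu).trans ?_
      gcongr
      exact le_max_left _ _
    · push Not at hL₀
      have hgap : g L W * Real.log L / L = (rectTorusHamiltonian Φ ![L, W]).spectralGap := by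
        rw [hg L W, div_mul_cancel₀ _ hlog.ne', mul_div_cancel_right₀ _ hLpos.ne']
      have hmemL : L ∈ Finset.range L₀ := Finset.mem_range.2 hL₀
      have hmemW : W ∈ Finset.range L₀ := Finset.mem_range.2 (hWL.trans_lt hL₀)
      have h1 : |g L W| ≤ ∑ W' ∈ Finset.range L₀, |g L W'| :=
        Finset.single_le_sum (f := fun W' => |g L W'|) (fun _ _ => abs_nonneg _) hmemW
      have h2 : ∑ W' ∈ Finset.range L₀, |g L W'| ≤
          ∑ L' ∈ Finset.range L₀, ∑ W' ∈ Finset.range L₀, |g L' W'| :=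
        Finset.single_le_sum (f := fun L' => ∑ W' ∈ Finset.range L₀, |g L' W'|)
          (fun _ _ => Finset.sum_nonneg fun _ _ => abs_nonneg _) hmemL
      rw [← hgap]
      gcongr
      exact (le_abs_self _).trans (h1.trans (h2.trans (le_max_right _ _)))
  · exact higherDim_lsm_of_odd_length Φ hrot _ L W hodd hW hu

/-- **`higherDim_lsm` from its even-length case.** If for every admissible `Φ` (finite range,
bounded, Hermitian, translation and rotation invariant) the gap bound of Nachtergaele–Sims (2007)
Thm 1.1 holds on the tori `ℤ/L × ℤ/W` with `L` even and at least some `L₀(Φ)`, `W ≤ L` odd, with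
a constant `C₀(Φ)`, then `higherDim_lsm` holds (by `higherDim_lsm_reduction`). This isolates the
printed theorem (even `L`, `L` large) as exactly what remains to be formalised.
Nachtergaele–Sims (2007) Thm 1.1. [cite: NachtergaeleSimsCMP2007, Thm 1.1] -/
theorem higherDim_lsm_of_even_case
    (heven : ∀ (Φ : LatticeInteraction 2 2) (R J : ℝ), Φ.HasFiniteRange R → Φ.IsBounded J →
      Φ.IsHermitian → Φ.IsTranslationInvariant → Φ.IsRotationInvariant →
      ∃ (L₀ : ℕ) (C₀ : ℝ), ∀ (L W : ℕ) [∀ i, NeZero (![L, W] i)], Even L → L₀ ≤ L → Odd W →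
        W ≤ L → (rectTorusHamiltonian Φ ![L, W]).HasUniqueGroundState →
          (rectTorusHamiltonian Φ ![L, W]).spectralGap ≤ C₀ * Real.log L / L) :
    higherDim_lsm := by
  intro Φ R J hR hJ hH hT hrot
  obtain ⟨L₀, C₀, h⟩ := heven Φ R J hR hJ hH hT hrot
  exact higherDim_lsm_reduction Φ hrot L₀ C₀ h

end OddLength

end HigherDimLSM

end Literature.MathematicalPhysics.QuantumLattice
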